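import Summits.QuantumAdvantage.QuantumAdvantage.Theorems.CharDialFormJuntaA

/-! # CharDialFormJuntaB — part 2/6 (mechanical split for landing of `CharDialFormJunta`; content verbatim; scopes re-opened with their variables) -/

noncomputable section
open Finset

namespace Summit.QuantumAdvantage.AdviceFreeQNC0.WindowCounter
open Summit.QuantumAdvantage.AdviceFreeQNC0

section PTransfer
variable (μ : ℕ → ℂ) (E : ℕ → List Bool → Bool → ℕ → Bool)
variable (Φ : ℕ → List Bool → ℕ → ℂ)

/-- **SCHEDULED CONTRACTION**: `‖PG_L(k)‖ ≤ 2^L κ^{nb(k, L)}` when every good position opens a contracting pair. -/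
theorem norm_PG_sched (hμ : ∀ i, ‖μ i‖ = 1) {β : ℝ} (hβ : 0 ≤ β) {W : ℕ} (gd : ℕ → Bool)
    (X X' : ℕ → Fin 3 → Bool) (hX : ∀ k, X' k ≠ X k) (hw : ∀ k, wt (X' k) = wt (X k) ∨ wt (X' k) = wt (X k) + 3)
    (hpair : ∀ k, gd k = true → ∀ a b : Bool, ‖tw μ k (X k) * sgn a + tw μ k (X' k) * sgn b‖ ≤ β)
    (hEl : ∀ k ρ ρ' b P, ρ.take W = ρ'.take W → E k ρ b P = E k ρ' b P) (hEp : ∀ k r b P, E k r b (P + 3) = E k r b P)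
    (hΦl : ∀ k ρ ρ' P, ρ.take W = ρ'.take W → Φ k ρ P = Φ k ρ' P) (hΦp : ∀ k r P, Φ k r (P + 3) = Φ k r P)
    (hΦ1 : ∀ k r P, ‖Φ k r P‖ ≤ 1) :
    ∀ L k r P, ‖PG μ E Φ L k r P‖ ≤ 2 ^ L * ((6 + β) / 8) ^ nb gd W k L := by
  intro L
  induction L using Nat.strong_induction_on with
  | _ L ih =>
  intro k r P
  have hκ0 : 0 ≤ (6 + β) / 8 := by positivity
  by_cases h : W + 3 ≤ L
  · by_cases hg : gd k = true
    · rw [nb_block h hg]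
      obtain ⟨L', rfl⟩ : ∃ L', L = L' + (W + 3) := ⟨L - (W + 3), by omega⟩
      rw [Nat.add_sub_cancel, PG_comp]
      have hb := norm_PG_block_le μ E (fun k' r' P' => PG μ E Φ L' k' r' P') hμ (X k) (X' k) (hX k) (hw k)
        (hpair k hg) (W := W) (fun k ρ ρ' P h => PG_local μ E Φ hEl hΦl _ _ h _)
        (fun k r P => PG_periodic μ E Φ hEp hΦp _ _ _ _) (M := 2 ^ L' * ((6 + β) / 8) ^ nb gd W (k + 3 + W) L')
        (by positivity) (fun r P => ih L' (by omega) (k + 3 + W) r P) r P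
      calc _ ≤ 2 ^ W * (6 + β) * (2 ^ L' * ((6 + β) / 8) ^ nb gd W (k + 3 + W) L') := hb
        _ = 2 ^ (L' + (W + 3)) * ((6 + β) / 8) ^ (nb gd W (k + 3 + W) L' + 1) := by ring
    · rw [nb_skip h hg]
      obtain ⟨L', rfl⟩ : ∃ L', L = L' + 1 := ⟨L - 1, by omega⟩
      rw [Nat.add_sub_cancel, PG_succ]
      have h0 := ih L' (by omega) (k + 1) (false :: r) P
      have h1 := ih L' (by omega) (k + 1) (true :: r) (P + 1)
      calc _ ≤ ‖sgn (E k r false P) * PG μ E Φ L' (k + 1) (false :: r) P‖ +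
              ‖μ k * sgn (E k r true P) * PG μ E Φ L' (k + 1) (true :: r) (P + 1)‖ := norm_add_le _ _
        _ ≤ 2 ^ L' * ((6 + β) / 8) ^ nb gd W (k + 1) L' + 2 ^ L' * ((6 + β) / 8) ^ nb gd W (k + 1) L' := by
            rw [norm_mul, norm_sgn, one_mul, norm_mul, norm_mul, hμ, norm_sgn, one_mul, one_mul]
            exact add_le_add h0 h1
        _ = 2 ^ (L' + 1) * ((6 + β) / 8) ^ nb gd W (k + 1) L' := by ring
  · rw [nb_tail h, pow_zero, mul_one]
    simpa using norm_PG_le_basic μ E Φ hμ (fun r P => hΦ1 (k + L) r P) r P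

/-- the number of good positions in `[k, k+L)`. -/
def cnt (gd : ℕ → Bool) (k L : ℕ) : ℕ := ∑ i ∈ Ico k (k + L), if gd i then 1 else 0

/-- CharDialFormJuntaB helper `cnt_le_len` (decomp-qadv land package; see the module docstring). -/
theorem cnt_le_len (gd : ℕ → Bool) (k L : ℕ) : cnt gd k L ≤ L := by
  unfold cnt
  calc _ ≤ ∑ _i ∈ Ico k (k + L), 1 := sum_le_sum fun i _ => by split_ifs <;> simp
    _ = L := by simp

/-- CharDialFormJuntaB helper `cnt_split` (decomp-qadv land package; see the module docstring). -/
theorem cnt_split (gd : ℕ → Bool) (k L₁ L : ℕ) (h : L₁ ≤ L) :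
    cnt gd k L = cnt gd k L₁ + cnt gd (k + L₁) (L - L₁) := by
  unfold cnt
  rw [show k + L₁ + (L - L₁) = k + L by omega]
  exact (sum_Ico_consecutive _ (by omega) (by omega)).symm

/-- CharDialFormJuntaB helper `cnt_one` (decomp-qadv land package; see the module docstring). -/
theorem cnt_one (gd : ℕ → Bool) (k : ℕ) : cnt gd k 1 = if gd k then 1 else 0 := by
  unfold cnt
  rw [Nat.Ico_succ_singleton, sum_singleton]

/-- **greedy covers the good positions**: `cnt ≤ (W+3)·nb + (W+2)`. -/
theorem cnt_le_nb (gd : ℕ → Bool) (W : ℕ) : ∀ L k, cnt gd k L ≤ (W + 3) * nb gd W k L + (W + 2) := by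
  intro L
  induction L using Nat.strong_induction_on with
  | _ L ih =>
  intro k
  by_cases h : W + 3 ≤ L
  · by_cases hg : gd k = true
    · rw [nb_block h hg, cnt_split gd k (W + 3) L h]
      have h1 := cnt_le_len gd k (W + 3)
      have h2 := ih (L - (W + 3)) (by omega) (k + 3 + W)
      rw [show k + (W + 3) = k + 3 + W by ring]
      linarith
    · rw [nb_skip h hg, cnt_split gd k 1 L (by omega), cnt_one, if_neg hg, zero_add]
      exact ih (L - 1) (by omega) (k + 1)
  · rw [nb_tail h]
    have := cnt_le_len gd k L
    omega

/-- hence: many good positions force many blocks. -/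
theorem le_nb_of_cnt (gd : ℕ → Bool) (W L k q : ℕ) (h : (W + 3) * q + (W + 2) < cnt gd k L + (W + 3)) :
    q ≤ nb gd W k L := by
  have := cnt_le_nb gd W L k
  by_contra hq
  push Not at hq
  have : (W + 3) * nb gd W k L + (W + 3) ≤ (W + 3) * q := by nlinarith
  omega

end PTransfer

/-! ## §G the FORM DIAL — window strategies consulting ANY linear form `⟨a,u⟩ mod p` lose (every prime `p ≥ 5`)

DENSE directions (`#{i : a_i ≠ 0} ≥ n/2`): the §F transfer with `μ i = ψ_p(t a_i)ψ₃(r)`; a block opened at any `k` with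
`a_k ≠ 0` contracts through one of the pairs `100/010`, `010/001`, `000/111` (`pair_XF`), so `≥ (n/2 − 2ℓ − 2)/(2ℓ+3)`
blocks contract and the twisted win sums `A_t^a(y) = Σ_u [WIN_y u] ψ_p(t⟨a,u⟩)` are `o(2ⁿ)` (`form_twist_small_dense`);
the Fourier reduction in the form value (`form_reduction`) then halves the distance to `1`.  SPARSE directions
(`#{i : a_i ≠ 0} ≤ n/2`): fix the bits on `supp a` — the form is constant on the subcube and the strategy is a
`2ℓ`-junta of the free bits, so the tree's `walkHardAllSubcube` applies (`form_sparse_hard`).  Together: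
`formWindow_hard`. -/

section FormDial

variable (p : ℕ) [Fact p.Prime] {n : ℕ}

/-- the linear form `⟨a,u⟩ = Σ_{u_i = 1} a_i`. -/
def linF (a : Fin n → ZMod p) (u : Fin n → Bool) : ZMod p := ∑ i, if u i then a i else 0

/-- a character of a finite sum is the product of the characters. -/
theorem char_sum {ι : Type*} (s : Finset ι) (f : ι → ZMod p) :
    (ZMod.stdAddChar (∑ i ∈ s, f i) : ℂ) = ∏ i ∈ s, (ZMod.stdAddChar (f i) : ℂ) := by
  classical
  induction s using Finset.induction_on with
  | empty => simp
  | @insert i s hi ih => rw [sum_insert hi, prod_insert hi, AddChar.map_add_eq_mul, ih]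

/-- the coefficients as a sequence (zero beyond `n`). -/
def aExt (a : Fin n → ZMod p) (i : ℕ) : ZMod p := if h : i < n then a ⟨i, h⟩ else 0

/-- CharDialFormJuntaB helper `aExt_val` (decomp-qadv land package; see the module docstring). -/
theorem aExt_val (a : Fin n → ZMod p) (i : Fin n) : aExt p a i.val = a i := by
  unfold aExt; rw [dif_pos i.isLt]

/-- the form twist `μ i = ψ_p(t a_i) ψ₃(r)`. -/
def muF (a : Fin n → ZMod p) (t : ZMod p) (r : ZMod 3) (i : ℕ) : ℂ :=
  (ZMod.stdAddChar (t * aExt p a i) : ℂ) * ZMod.stdAddChar r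

/-- CharDialFormJuntaB helper `norm_muF` (decomp-qadv land package; see the module docstring). -/
theorem norm_muF (a : Fin n → ZMod p) (t : ZMod p) (r : ZMod 3) (i : ℕ) : ‖muF p a t r i‖ = 1 := by
  unfold muF; rw [norm_mul, norm_char, norm_char, mul_one]

/-- the collected twist along the whole input = the form character times the class twist. -/
theorem tw_muF (a : Fin n → ZMod p) (t : ZMod p) (r : ZMod 3) (u : Fin n → Bool) :
    tw (muF p a t r) 0 u = (ZMod.stdAddChar (t * linF p a u) : ℂ) * (ZMod.stdAddChar r : ℂ) ^ wt u := by
  unfold tw linF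
  rw [mul_sum, char_sum]
  have hpow : (ZMod.stdAddChar r : ℂ) ^ wt u = ∏ i : Fin n, if u i then (ZMod.stdAddChar r : ℂ) else 1 := by
    rw [prod_ite, prod_const_one, mul_one, prod_const]; rfl
  rw [hpow, ← prod_mul_distrib]
  refine prod_congr rfl fun i _ => ?_
  rw [zero_add, muF, aExt_val]
  by_cases h : u i = true
  · simp [h]
  · simp [h]

/-- the plain form-twisted sum is a `PG`. -/
theorem sum_tw_eq_PG (μ : ℕ → ℂ) (n : ℕ) :
    ∑ u : Fin n → Bool, tw μ 0 u = PG μ (fun _ _ _ _ => false) (fun _ _ _ => 1) n 0 [] 0 := by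
  unfold PG pathSgn; simp

/-! ### the contraction constant for position-dependent twists -/

/-- CharDialFormJuntaB helper `univ_erase_zero_nonempty` (decomp-qadv land package; see the module docstring). -/
theorem univ_erase_zero_nonempty : (univ.erase (0 : ZMod p)).Nonempty :=
  ⟨1, mem_erase.2 ⟨one_ne_zero, mem_univ _⟩⟩

/-- `β_F(p) = max_{z ≠ 0} ‖1 ± ψ_p(z)‖ < 2`. -/
def betaF : ℝ := (univ.erase (0 : ZMod p)).sup' (univ_erase_zero_nonempty p)
  fun z => max ‖1 + (ZMod.stdAddChar z : ℂ)‖ ‖1 - (ZMod.stdAddChar z : ℂ)‖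

/-- CharDialFormJuntaB helper `two_ne_zero'` (decomp-qadv land package; see the module docstring). -/
theorem two_ne_zero' (hp : 5 ≤ p) : ((2 : ℕ) : ZMod p) ≠ 0 := by
  intro h
  rw [ZMod.natCast_eq_zero_iff] at h
  have := Nat.le_of_dvd (by norm_num) h; omega

/-- CharDialFormJuntaB helper `three_ne_zero'` (decomp-qadv land package; see the module docstring). -/
theorem three_ne_zero' (hp : 5 ≤ p) : ((3 : ℕ) : ZMod p) ≠ 0 := by
  intro h
  rw [ZMod.natCast_eq_zero_iff] at h
  have := Nat.le_of_dvd (by norm_num) h; omega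

/-- CharDialFormJuntaB helper `betaF_lt_two` (decomp-qadv land package; see the module docstring). -/
theorem betaF_lt_two (hp : 5 ≤ p) : betaF p < 2 := by
  unfold betaF
  rw [sup'_lt_iff]
  intro z hz
  have hz0 : z ≠ 0 := (mem_erase.1 hz).1
  refine max_lt (norm_one_add_lt_two (norm_char p z) (char_ne_one p hz0)) ?_
  rw [sub_eq_add_neg]
  refine norm_one_add_lt_two (by rw [norm_neg, norm_char]) fun h => ?_
  have h2 : (ZMod.stdAddChar (((2 : ℕ) : ZMod p) * z) : ℂ) = 1 := by
    rw [char_natMul, show (ZMod.stdAddChar z : ℂ) = -1 by rw [← neg_neg (ZMod.stdAddChar z : ℂ), h]]; norm_num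
  exact char_ne_one p (mul_ne_zero (two_ne_zero' p hp) hz0) h2

/-- CharDialFormJuntaB helper `le_betaF` (decomp-qadv land package; see the module docstring). -/
theorem le_betaF {z : ZMod p} (hz : z ≠ 0) :
    ‖1 + (ZMod.stdAddChar z : ℂ)‖ ≤ betaF p ∧ ‖1 - (ZMod.stdAddChar z : ℂ)‖ ≤ betaF p := by
  have := le_sup' (fun z => max ‖1 + (ZMod.stdAddChar z : ℂ)‖ ‖1 - (ZMod.stdAddChar z : ℂ)‖)
    (mem_erase.2 ⟨hz, mem_univ z⟩)
  exact ⟨le_trans (le_max_left _ _) this, le_trans (le_max_right _ _) this⟩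

/-- CharDialFormJuntaB helper `betaF_nonneg` (decomp-qadv land package; see the module docstring). -/
theorem betaF_nonneg : 0 ≤ betaF p := le_trans (norm_nonneg _) (le_betaF p one_ne_zero).1

/-- the rate `κ_F = (6 + β_F)/8 < 1`. -/
def kappaF : ℝ := (6 + betaF p) / 8

/-- CharDialFormJuntaB helper `kappaF_nonneg` (decomp-qadv land package; see the module docstring). -/
theorem kappaF_nonneg : 0 ≤ kappaF p := by unfold kappaF; have := betaF_nonneg p; positivity

/-- CharDialFormJuntaB helper `kappaF_lt_one` (decomp-qadv land package; see the module docstring). -/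
theorem kappaF_lt_one (hp : 5 ≤ p) : kappaF p < 1 := by unfold kappaF; have := betaF_lt_two p hp; linarith

/-- a unit times a `β`-bounded sign combination. -/
theorem norm_pair_le (c ν : ℂ) (hc : ‖c‖ = 1) {β : ℝ} (h1 : ‖1 + ν‖ ≤ β) (h2 : ‖1 - ν‖ ≤ β) (a b : Bool) :
    ‖c * sgn a + c * ν * sgn b‖ ≤ β := by
  have : c * sgn a + c * ν * sgn b = c * (sgn a + ν * sgn b) := by ring
  rw [this, norm_mul, hc, one_mul]
  cases a <;> cases b <;> simp only [sgn_true, sgn_false, mul_one, mul_neg]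
  · exact h1
  · rw [← sub_eq_add_neg]; exact h2
  · rw [← norm_neg, neg_add, neg_neg, ← sub_eq_add_neg]; exact h2
  · rw [← norm_neg, neg_add, neg_neg, neg_neg]; exact h1

/-! ### the three contracting pairs of openings -/

/-- CharDialFormJuntaB helper `P100` (decomp-qadv land package; see the module docstring). -/
def P100 : Fin 3 → Bool := ![true, false, false]
/-- CharDialFormJuntaB helper `P010` (decomp-qadv land package; see the module docstring). -/
def P010 : Fin 3 → Bool := ![false, true, false]
/-- CharDialFormJuntaB helper `P001` (decomp-qadv land package; see the module docstring). -/
def P001 : Fin 3 → Bool := ![false, false, true]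
/-- CharDialFormJuntaB helper `P000` (decomp-qadv land package; see the module docstring). -/
def P000 : Fin 3 → Bool := ![false, false, false]
/-- CharDialFormJuntaB helper `P111` (decomp-qadv land package; see the module docstring). -/
def P111 : Fin 3 → Bool := ![true, true, true]

/-- CharDialFormJuntaB helper `tw_P100` (decomp-qadv land package; see the module docstring). -/
theorem tw_P100 (μ : ℕ → ℂ) (k : ℕ) : tw μ k P100 = μ k := by
  simp [tw, P100, Fin.prod_univ_three]
/-- CharDialFormJuntaB helper `tw_P010` (decomp-qadv land package; see the module docstring). -/
theorem tw_P010 (μ : ℕ → ℂ) (k : ℕ) : tw μ k P010 = μ (k + 1) := by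
  simp [tw, P010, Fin.prod_univ_three]
/-- CharDialFormJuntaB helper `tw_P001` (decomp-qadv land package; see the module docstring). -/
theorem tw_P001 (μ : ℕ → ℂ) (k : ℕ) : tw μ k P001 = μ (k + 2) := by
  simp [tw, P001, Fin.prod_univ_three]
/-- CharDialFormJuntaB helper `tw_P000` (decomp-qadv land package; see the module docstring). -/
theorem tw_P000 (μ : ℕ → ℂ) (k : ℕ) : tw μ k P000 = 1 := by
  simp [tw, P000, Fin.prod_univ_three]
/-- CharDialFormJuntaB helper `tw_P111` (decomp-qadv land package; see the module docstring). -/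
theorem tw_P111 (μ : ℕ → ℂ) (k : ℕ) : tw μ k P111 = μ k * μ (k + 1) * μ (k + 2) := by
  simp [tw, P111, Fin.prod_univ_three, mul_assoc]

/-- CharDialFormJuntaB helper `wt_P100` (decomp-qadv land package; see the module docstring). -/
theorem wt_P100 : wt P100 = 1 := by decide
/-- CharDialFormJuntaB helper `wt_P010` (decomp-qadv land package; see the module docstring). -/
theorem wt_P010 : wt P010 = 1 := by decide
/-- CharDialFormJuntaB helper `wt_P001` (decomp-qadv land package; see the module docstring). -/
theorem wt_P001 : wt P001 = 1 := by decide
/-- CharDialFormJuntaB helper `wt_P000` (decomp-qadv land package; see the module docstring). -/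
theorem wt_P000 : wt P000 = 0 := by decide
/-- CharDialFormJuntaB helper `wt_P111` (decomp-qadv land package; see the module docstring). -/
theorem wt_P111 : wt P111 = 3 := by decide

/-- good positions: `a_k ≠ 0`. -/
def gdF (a : Fin n → ZMod p) (k : ℕ) : Bool := decide (aExt p a k ≠ 0)

/-- the first opening of the pair at `k`. -/
def XF (a : Fin n → ZMod p) (k : ℕ) : Fin 3 → Bool :=
  if aExt p a k ≠ aExt p a (k + 1) then P100 else if aExt p a (k + 1) ≠ aExt p a (k + 2) then P010 else P000

/-- the second opening of the pair at `k`. -/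
def XF' (a : Fin n → ZMod p) (k : ℕ) : Fin 3 → Bool :=
  if aExt p a k ≠ aExt p a (k + 1) then P010 else if aExt p a (k + 1) ≠ aExt p a (k + 2) then P001 else P111

/-- CharDialFormJuntaB helper `XF'_ne` (decomp-qadv land package; see the module docstring). -/
theorem XF'_ne (a : Fin n → ZMod p) (k : ℕ) : XF' p a k ≠ XF p a k := by
  unfold XF XF'
  split_ifs <;> decide

/-- CharDialFormJuntaB helper `wt_XF` (decomp-qadv land package; see the module docstring). -/
theorem wt_XF (a : Fin n → ZMod p) (k : ℕ) :
    wt (XF' p a k) = wt (XF p a k) ∨ wt (XF' p a k) = wt (XF p a k) + 3 := by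
  unfold XF XF'
  split_ifs
  · left; rw [wt_P010, wt_P100]
  · left; rw [wt_P001, wt_P010]
  · right; rw [wt_P111, wt_P000]

/-- CharDialFormJuntaB helper `muF_step` (decomp-qadv land package; see the module docstring). -/
theorem muF_step (a : Fin n → ZMod p) (t : ZMod p) (r : ZMod 3) (i j : ℕ) :
    muF p a t r j = muF p a t r i * ZMod.stdAddChar (t * (aExt p a j - aExt p a i)) := by
  unfold muF
  rw [mul_right_comm, ← AddChar.map_add_eq_mul]
  congr 2; ring

/-- **at a good position the pair contracts**: `‖tw X σ + tw X' σ'‖ ≤ β_F` for all signs. -/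
theorem pair_XF (hp : 5 ≤ p) (a : Fin n → ZMod p) {t : ZMod p} (ht : t ≠ 0) (r : ZMod 3) (k : ℕ)
    (hk : gdF p a k = true) (σ σ' : Bool) :
    ‖tw (muF p a t r) k (XF p a k) * sgn σ + tw (muF p a t r) k (XF' p a k) * sgn σ'‖ ≤ betaF p := by
  have hk0 : aExt p a k ≠ 0 := by simpa [gdF] using hk
  unfold XF XF'
  split_ifs with h1 h2
  · rw [tw_P100, tw_P010, muF_step p a t r k (k + 1)]
    have hz : t * (aExt p a (k + 1) - aExt p a k) ≠ 0 := mul_ne_zero ht (sub_ne_zero.2 (Ne.symm h1))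
    exact norm_pair_le _ _ (norm_muF p a t r k) (le_betaF p hz).1 (le_betaF p hz).2 σ σ'
  · rw [tw_P010, tw_P001, muF_step p a t r (k + 1) (k + 2)]
    have hz : t * (aExt p a (k + 2) - aExt p a (k + 1)) ≠ 0 := mul_ne_zero ht (sub_ne_zero.2 (Ne.symm h2))
    exact norm_pair_le _ _ (norm_muF p a t r (k + 1)) (le_betaF p hz).1 (le_betaF p hz).2 σ σ'
  · push Not at h1 h2
    rw [tw_P000, tw_P111]
    have e : muF p a t r k * muF p a t r (k + 1) * muF p a t r (k + 2) =
        1 * ZMod.stdAddChar (((3 : ℕ) : ZMod p) * (t * aExt p a k)) := by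
      unfold muF
      rw [← h2, ← h1, char_natMul]
      have h3 : (ZMod.stdAddChar r : ℂ) ^ 3 = 1 := by
        rw [← char_natMul, show ((3 : ℕ) : ZMod 3) = 0 by decide, zero_mul, AddChar.map_zero_eq_one]
      linear_combination (ZMod.stdAddChar (t * aExt p a k) : ℂ) ^ 3 * h3
    rw [e, show (1 : ℂ) * sgn σ = 1 * sgn σ from rfl]
    have hz : ((3 : ℕ) : ZMod p) * (t * aExt p a k) ≠ 0 := mul_ne_zero (three_ne_zero' p hp) (mul_ne_zero ht hk0)
    exact norm_pair_le 1 _ norm_one (le_betaF p hz).1 (le_betaF p hz).2 σ σ'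


end FormDial
end Summit.QuantumAdvantage.AdviceFreeQNC0.WindowCounter
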